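import Std.Tactic.BVDecide.Reflect
import Summits.Ventures.QEC.Census.LRATLeaves
import HarnessLib

/-!
# Kernel-B certificates: the CHECKED-native LRAT hook (`Std.Tactic.BVDecide.Reflect.verifyCert`)

Cell `qec`, PARTITION v2 row type-11 — the tier-COMPILED / CHECKED-native entry point of the kernel-B
pipeline (director D3: a file closed by `native_decide` carries the axiom `Lean.ofReduceBool` and is never
counted as CERTIFIED; the KERNEL-std path is `Census/KernelReplay.lean`).  Lean core's `verifyCert cnf cert`
parses an LRAT proof given as a `String` (text or binary LRAT, `LRAT.parseLRATProof`) and runs the verified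
checker `LRAT.check`; `verifyCert_correct` turns `= true` into `cnf.Unsat`.  Composed with the ENCODING
SOUNDNESS of the Lean `enc-v1` encoder this gives, for a certificate string `cert`:

* `not_solves_of_verifyCert` — `verifyCert (cnfEncode n rows u w) cert = true` ⟹ no solution of `Q(H,u,w)`;
* `not_solvesAny_of_verifyCert` — the `Q_any` twin;
* `leafCNF_unsat_of_verifyCert` — the `enc-v2` leaf form consumed by `LRATLeaves` / `LRATLeavesBB`.

Usage (one module per solver piece, measured ≈ 1 s per 100 KB of LRAT on the farm):
`theorem piece_unsat : (leafCNF 72 HX LX 5 [] q).Unsat := leafCNF_unsat_of_verifyCert _ _ _ _ _ _ lratText (by native_decide)`.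
-/

namespace Summit.Ventures.QEC.Census.LRATBridge

open Std.Sat Std.Tactic.BVDecide Summit.Ventures.QEC.Census.CNFEncode

/-- CHECKED-native hook for `Q(H,u,w)`: an LRAT certificate string accepted by Lean core's `verifyCert` for the
Lean-built CNF excludes every solution. -/
theorem not_solves_of_verifyCert {n : ℕ} {rows : List (List ℕ)} {u : List ℕ} {w : ℕ} (cert : String)
    (h : Reflect.verifyCert (cnfEncode n rows u w) cert = true)
    (hrows : ∀ r ∈ rows, ∀ i ∈ r, i < n) (hu : ∀ i ∈ u, i < n) (a : ℕ → Bool) :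
    ¬ Solves n rows u w a :=
  fun ha => cnfEncode_unsat_imp hrows hu (Reflect.verifyCert_correct _ cert h) ⟨a, ha⟩

/-- CHECKED-native hook for `Q_any(H,U,w)`. -/
theorem not_solvesAny_of_verifyCert {n : ℕ} {rows : List (List ℕ)} {us : List (List ℕ)} {w : ℕ}
    (cert : String) (h : Reflect.verifyCert (cnfEncodeAny n rows us w) cert = true)
    (hrows : ∀ r ∈ rows, ∀ i ∈ r, i < n) (hus : ∀ u ∈ us, ∀ i ∈ u, i < n) (a : ℕ → Bool) :
    ¬ SolvesAny n rows us w a :=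
  fun ha => cnfEncodeAny_unsat_imp hrows hus (Reflect.verifyCert_correct _ cert h) ⟨a, ha⟩

/-- CHECKED-native hook for an `enc-v2` leaf: `verifyCert (leafCNF …) cert = true ⟹ (leafCNF …).Unsat` — the
hypothesis shape `hleaf` of the assembly theorems, at tier COMPILED. -/
theorem leafCNF_unsat_of_verifyCert (n : ℕ) (rows us : List (List ℕ)) (w : ℕ) (pre q : List (Literal ℕ))
    (cert : String) (h : Reflect.verifyCert (leafCNF n rows us w pre q) cert = true) :
    (leafCNF n rows us w pre q).Unsat :=
  Reflect.verifyCert_correct _ cert h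

/-- CHECKED-native hook for a coverage CNF. -/
theorem coverCNF_unsat_of_verifyCert (o : ℕ) (cubes : List (List (Literal ℕ))) (cert : String)
    (h : Reflect.verifyCert (coverCNF o cubes) cert = true) : (coverCNF o cubes).Unsat :=
  Reflect.verifyCert_correct _ cert h

end Summit.Ventures.QEC.Census.LRATBridge
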